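import Summits.ABC.IUTFork.Thm311RealArchHermitianIndDH
import Summits.ABC.IUTFork.Cor312VolumesRealArch
import HarnessLib

/-!
# [IUTchIII] Theorem 3.11 (i) (Ind2) at `v_ℚ = ∞`, PRINT-LITERAL: the factor-wise signs of [AbsTopIII] Prop. 5.8 (v)
# (the Klein four-group `{1, −1, conj, −conj}` on `K_w ≅ ℂ`) versus the typed `{1, −1}` — a proper enlargement at
# every complex place that changes NO archimedean quantity of the cell's real instantiation

Record file (D-0012) of the abc-iut cell (WAVE-4 D-0067 cone-interior discharge prover, seat abc-iut-w4-d001, gen 2;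
home layer L6); TAKES NO SIDE on [IUTchIII] Cor. 3.12. Sequel to this seat's archimedean dossier
(`Thm311RealArchShell`, `…ArchHermitian`, `…ArchHermitianInd`, `…ArchHermitianIndDH`).

THE RESIDUAL. abc-iut-c312-5's Dupuy–Hilado-level real signature `Real.logShellsDH` types (Ind2) at an archimedean
place `w` as `Real.ismDH (inl w) = {1, −1}` and RECORDS (its module docstring, "RESIDUAL") that print's order-2
automorphisms act FACTOR-WISE: [IUTchIII] Thm. 3.11 (i) (Ind2) at `v_ℚ ∈ 𝕍^arc_ℚ` is "copies of each of the
automorphisms of order 2 whose orbit constitutes the poly-automorphism discussed in Proposition 1.2, (vii)" (kurims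
`paper:url-4b091feeb646` p. 154), and Prop. 1.2 (vii) (p. 33, read verbatim in the cell's render) reads that poly-automorphism as "an orbit of isomorphisms with respect to the independent actions of
`{±1}` on each of the direct factors that occur in the construction of [AbsTopIII], Proposition 5.8, (v)", where
[AbsTopIII] Prop. 5.8 (v) (kurims `paper:url-5493eb38cbb7` p. 140) constructs `k~(G) = C~ × C~` — TWO direct factors
(each a topological group `≅ ℝ`), log-shell `I(G) = {(a·x, b·x) | x ∈ I_{C~}, a² + b² = 1}`. Independent signs on the
two real axes of `K_w ≅ ℂ` generate the Klein four-group `{1, −1, conj, −conj}` (abc-iut-w4-d062's audit note I1 on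
`Thm311RealArchHermitianIndDH`, 2026-08-26, records the same reading).

TYPED here (data, no `Prop`-valued definition, no instance/notation):
* `Real.conjCarrier w` — complex conjugation of `K_w` (transported along Mathlib's `ringEquivComplexOfIsComplex`
  at a complex place; the identity at a real place, where `K_w = ℝ`), with `extensionEmbedding_conjCarrier`:
  `K_w ↪ ℂ` intertwines it with `conj`;
* `Real.ismPrintArch logv` — the (Ind2)-binder that is c312-5's `Real.ismDH` at the finite places and the Klein
  four-group `{1, −1, conjCarrier w, conjCarrier w ≫ (−1)}` at `inl w`; `Real.logShellsPrintArch X logv` — the real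
  signature with THIS binder (strip-automorphisms `stripAutDH`, unchanged).
PROVED here:
* `Real.ismDH_subset_ismPrintArch` — typed ⊆ print at every place; **`Real.conjCarrier_not_mem_ismDH`** /
  **`Real.ismDH_ssubset_ismPrintArch`** — at every COMPLEX place the typed binder is a PROPER subset of print's
  (finding F-w4d001-g2-2, neutral: the typed (Ind2) at `∞` is a smaller indeterminacy than print's — a hull of
  (Ind1,2,3)-images formed over the typed binder quantifies over FEWER images; for the record of the referees'
  «typed vs print» census, direction: typed-narrower-than-print at `∞`), exactly there:
  `Real.ismPrintArch_eq_ismDH_of_not_isComplex` (at a real place the two binders coincide);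
* and that the enlargement is NUMERICALLY IDLE for everything the cell instantiated at `∞`:
  `Real.isometric_ismPrintArch_inl` (every element is read in `ℂ` as a real-linear isometry: `1`, `−1`,
  `Complex.conjLIE`, `−conjLIE`), hence **`Real.preimage_archPkHermitian_of_mem_Ind2_printArch`** (print's archimedean
  integral structure `𝓘(^{S^±_{j+1}}𝒟⊢_∞)` = this seat's `archPkHermitian` is fixed by EVERY element of the print-literal
  (Ind2) at `∞` — the general lemma `preimage_archPkHermitian_of_mem_Ind2` of `…IndDH`), and
  **`Real.archPresentationPrintArch`**: abc-iut-w5-d163's archimedean presentation (`Cor312VolumesArchSummands`,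
  `Cor312VolumesRealArch.archPresentationDH`: `φ_v = extensionEmbedding`, shell = closed ball of radius `π`, binders
  acting by isometries of `ℂ`) EXISTS VERBATIM over the enlarged signature, so its whole archimedean container
  (admissibility, log-measure, invariance under (Ind1)/(Ind2), `GeneratorsPreserve`:
  `Real.generatorsPreservePrintArch`) carries over with the same values (`toLocalPieces_printArch_{X,adm,logμ,w}_eq`, all `rfl`).
So the recorded residual is closed in the only sense that bears on volumes: replacing `{±1}` by print's factor-wise
signs at `∞` changes neither print's integral structure's stability nor any archimedean log-volume.
[claim: Mochizuki2012, status: disputed] for every quotation; classical. typed ≠ proved; instantiated ≠ endorsed.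
Deliberately NOT here: re-assembling abc-iut-c312-1's probability-weighted container over the enlarged signature (its
combinators `localPiecesPrWith`/`summandPiecesPrWith` and c312-5's prime presentations are typed over `logShellsDH`;
over `logShellsPrintArch` the `∞`-input would be `(archPresentationPrintArch …).toLocalPieces`, supplied here, and the
prime pieces do not see the archimedean binder), any judgement.
-/

noncomputable section

namespace Summit.ABC.IUTFork.Thm311.Real

open NumberField Literature.IUT.LogVolume Literature.IUT.LogVolume.Prop15iii Literature.IUT.LogThetaLattice
open PiTensorProduct
open scoped ComplexConjugate

variable {F : Type} [Field F] [NumberField F]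

/-! ## 1. Complex conjugation of `K_w` -/

/-- Complex conjugation of the carrier `K_w` at a COMPLEX place, transported along Mathlib's ring isomorphism
`K_w ≃+* ℂ` (`ringEquivComplexOfIsComplex`, i.e. `extensionEmbedding`). [folklore] -/
def conjRingEquiv {w : InfinitePlace F} (hw : w.IsComplex) :
    Carrier (.inl w : Place F) ≃+* Carrier (.inl w : Place F) :=
  (InfinitePlace.Completion.ringEquivComplexOfIsComplex hw).trans
    ((starRingAut : RingAut ℂ).trans (InfinitePlace.Completion.ringEquivComplexOfIsComplex hw).symm)

/-- `K_w ↪ ℂ` intertwines `conjRingEquiv` with complex conjugation. [folklore] -/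
theorem extensionEmbedding_conjRingEquiv {w : InfinitePlace F} (hw : w.IsComplex) (a : Carrier (.inl w : Place F)) :
    InfinitePlace.Completion.extensionEmbedding w (conjRingEquiv hw a) =
      conj (InfinitePlace.Completion.extensionEmbedding w a) := by
  show InfinitePlace.Completion.extensionEmbedding w
      ((InfinitePlace.Completion.ringEquivComplexOfIsComplex hw).symm
        (starRingAut (InfinitePlace.Completion.ringEquivComplexOfIsComplex hw a))) = _
  rw [← InfinitePlace.Completion.ringEquivComplexOfIsComplex_apply hw, RingEquiv.apply_symm_apply,
    starRingAut_apply, InfinitePlace.Completion.ringEquivComplexOfIsComplex_apply]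
  rfl

open scoped Classical in
/-- **Complex conjugation of `K_w`** as a `ℚ`-linear automorphism of the carrier `log(𝒟⊢_w) := K_w`: at a complex
place the transported conjugation, at a real place (`K_w = ℝ`, on which conjugation is trivial) the identity.
[folklore] -/
def conjCarrier (w : InfinitePlace F) : Carrier (.inl w : Place F) ≃ₗ[ℚ] Carrier (.inl w : Place F) :=
  if hw : w.IsComplex then
    { (conjRingEquiv hw).toAddEquiv with
      map_smul' := fun c a => map_rat_smul (conjRingEquiv hw) c a }
  else LinearEquiv.refl ℚ _

/-- At a complex place `conjCarrier` is the transported conjugation. [folklore] -/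
theorem conjCarrier_apply_of_isComplex {w : InfinitePlace F} (hw : w.IsComplex) (a : Carrier (.inl w : Place F)) :
    conjCarrier w a = conjRingEquiv hw a := by
  classical
  unfold conjCarrier
  rw [dif_pos hw]
  rfl

/-- At a real place `conjCarrier` is the identity. [folklore] -/
theorem conjCarrier_apply_of_not_isComplex {w : InfinitePlace F} (hw : ¬ w.IsComplex)
    (a : Carrier (.inl w : Place F)) : conjCarrier w a = a := by
  classical
  unfold conjCarrier
  rw [dif_neg hw]
  rfl

/-- **`K_w ↪ ℂ` intertwines `conjCarrier w` with complex conjugation** (at a real place both sides are the real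
number `extensionEmbedding w a`). [folklore] -/
theorem extensionEmbedding_conjCarrier (w : InfinitePlace F) (a : Carrier (.inl w : Place F)) :
    InfinitePlace.Completion.extensionEmbedding w (conjCarrier w a) =
      conj (InfinitePlace.Completion.extensionEmbedding w a) := by
  by_cases hw : w.IsComplex
  · rw [conjCarrier_apply_of_isComplex hw]
    exact extensionEmbedding_conjRingEquiv hw a
  · have hr : w.IsReal := InfinitePlace.not_isComplex_iff_isReal.mp hw
    rw [conjCarrier_apply_of_not_isComplex hw]
    have h := InfinitePlace.Completion.extensionEmbeddingOfIsReal_apply hr a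
    rw [← h, Complex.conj_ofReal]

/-- `conjCarrier w` is an involution ("automorphisms of order 2", [IUTchIII] Thm. 3.11 (i) (Ind2)). [folklore] -/
theorem conjCarrier_conjCarrier (w : InfinitePlace F) (a : Carrier (.inl w : Place F)) :
    conjCarrier w (conjCarrier w a) = a := by
  by_cases hw : w.IsComplex
  · rw [conjCarrier_apply_of_isComplex hw, conjCarrier_apply_of_isComplex hw]
    show (InfinitePlace.Completion.ringEquivComplexOfIsComplex hw).symm (starRingAut
        (InfinitePlace.Completion.ringEquivComplexOfIsComplex hw
          ((InfinitePlace.Completion.ringEquivComplexOfIsComplex hw).symm (starRingAut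
            (InfinitePlace.Completion.ringEquivComplexOfIsComplex hw a))))) = a
    rw [RingEquiv.apply_symm_apply, starRingAut_apply, starRingAut_apply, star_star, RingEquiv.symm_apply_apply]
  · rw [conjCarrier_apply_of_not_isComplex hw, conjCarrier_apply_of_not_isComplex hw]

/-- Hence `conjCarrier w ≫ conjCarrier w = 1`: every element of the print-literal binder below has order `≤ 2`. [folklore] -/
theorem conjCarrier_trans_conjCarrier (w : InfinitePlace F) :
    (conjCarrier w).trans (conjCarrier w) = LinearEquiv.refl ℚ (Carrier (.inl w : Place F)) :=
  LinearEquiv.ext fun a => conjCarrier_conjCarrier w a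

/-- At a complex place `conjCarrier w ≠ 1` (it moves a preimage of `√−1`). [folklore] -/
theorem conjCarrier_ne_refl {w : InfinitePlace F} (hw : w.IsComplex) :
    conjCarrier w ≠ LinearEquiv.refl ℚ (Carrier (.inl w : Place F)) := by
  intro h
  obtain ⟨a, ha⟩ := InfinitePlace.Completion.surjective_extensionEmbedding_of_isComplex hw Complex.I
  have h1 := extensionEmbedding_conjCarrier w a
  rw [h, LinearEquiv.refl_apply] at h1
  have h2 : InfinitePlace.Completion.extensionEmbedding w a = Complex.I := ha
  rw [h2, Complex.conj_I] at h1
  have h3 := congrArg Complex.im h1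
  norm_num at h3

/-- At a complex place `conjCarrier w ≠ −1` (it fixes a preimage of `1`). [folklore] -/
theorem conjCarrier_ne_neg {w : InfinitePlace F} (hw : w.IsComplex) :
    conjCarrier w ≠ LinearEquiv.neg ℚ (M := Carrier (.inl w : Place F)) := by
  intro h
  obtain ⟨a, ha⟩ := InfinitePlace.Completion.surjective_extensionEmbedding_of_isComplex hw 1
  have h1 := extensionEmbedding_conjCarrier w a
  rw [h, LinearEquiv.neg_apply] at h1
  have hneg : InfinitePlace.Completion.extensionEmbedding w (-a) =
      -InfinitePlace.Completion.extensionEmbedding w a := map_neg _ a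
  have h2 : InfinitePlace.Completion.extensionEmbedding w a = 1 := ha
  have h3 : (-1 : ℂ) = conj (1 : ℂ) := by
    rw [← h2, ← hneg]
    exact h1
  rw [map_one] at h3
  have h4 := congrArg Complex.re h3
  norm_num at h4

/-! ## 2. The print-literal (Ind2)-binder and the real signature carrying it -/

/-- **(Ind2) at the real carriers, PRINT-LITERAL at `∞`**: at a finite place abc-iut-c312-5's Dupuy–Hilado group
`Real.ismDH` (unchanged); at an archimedean place `w` the factor-wise signs of [AbsTopIII] Prop. 5.8 (v) on
`k~ = C~ × C~`, i.e. the Klein four-group `{1, −1, conj, −conj}` of `K_w` ([IUTchIII] Thm. 3.11 (i) (Ind2) /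
Prop. 1.2 (vii): "the independent actions of `{±1}` on each of the direct factors").
[claim: Mochizuki2012, status: disputed] -/
def ismPrintArch (logv : PadicLogs F) : ∀ x : Place F, Set (Carrier x ≃ₗ[ℚ] Carrier x)
  | .inl w => {LinearEquiv.refl ℚ (Carrier (.inl w)), LinearEquiv.neg ℚ, conjCarrier w,
      (conjCarrier w).trans (LinearEquiv.neg ℚ)}
  | .inr v => ismDH logv (.inr v)

variable (logv : PadicLogs F)

/-- The identity belongs to the print-literal binder. [folklore] -/
theorem refl_mem_ismPrintArch (x : Place F) : LinearEquiv.refl ℚ (Carrier x) ∈ ismPrintArch logv x := by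
  cases x with
  | inl w => exact Or.inl rfl
  | inr v => exact refl_mem_ismDH logv (.inr v)

/-- **Typed ⊆ print**: c312-5's (Ind2)-binder is contained in the print-literal one at every place.
[claim: Mochizuki2012, status: disputed] -/
theorem ismDH_subset_ismPrintArch (x : Place F) : ismDH logv x ⊆ ismPrintArch logv x := by
  cases x with
  | inl w =>
    intro g hg
    rcases hg with rfl | hg
    · exact Or.inl rfl
    · exact Or.inr (Or.inl hg)
  | inr v => exact fun g hg => hg

/-- Complex conjugation belongs to the print-literal binder at `∞`. [folklore] -/
theorem conjCarrier_mem_ismPrintArch (w : InfinitePlace F) : conjCarrier w ∈ ismPrintArch logv (.inl w) :=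
  Or.inr (Or.inr (Or.inl rfl))

/-- **Complex conjugation is NOT in the typed binder** at a complex place (`ismDH (inl w) = {1, −1}`).
[claim: Mochizuki2012, status: disputed] -/
theorem conjCarrier_not_mem_ismDH {w : InfinitePlace F} (hw : w.IsComplex) : conjCarrier w ∉ ismDH logv (.inl w) := by
  intro h
  rcases h with h | h
  · exact conjCarrier_ne_refl hw h
  · exact conjCarrier_ne_neg hw h

/-- **Finding F-w4d001-g2-2 (neutral): at every COMPLEX place the typed (Ind2)-binder is a PROPER subset of the
print-literal one** — the typed indeterminacy at `∞` is narrower than print's. [claim: Mochizuki2012, status: disputed] -/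
theorem ismDH_ssubset_ismPrintArch {w : InfinitePlace F} (hw : w.IsComplex) :
    ismDH logv (.inl w) ⊂ ismPrintArch logv (.inl w) :=
  Set.ssubset_iff_subset_ne.mpr ⟨ismDH_subset_ismPrintArch logv (.inl w), fun h =>
    conjCarrier_not_mem_ismDH logv hw (h ▸ conjCarrier_mem_ismPrintArch logv w)⟩

/-- At a REAL place conjugation is trivial: `conjCarrier w = 1`. [folklore] -/
theorem conjCarrier_eq_refl_of_not_isComplex {w : InfinitePlace F} (hw : ¬ w.IsComplex) :
    conjCarrier w = LinearEquiv.refl ℚ (Carrier (.inl w : Place F)) :=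
  LinearEquiv.ext fun a => conjCarrier_apply_of_not_isComplex hw a

/-- **The enlargement happens EXACTLY at the complex places**: at a real place the print-literal binder IS the
typed one (`{1, −1, 1, −1} = {1, −1}`). [claim: Mochizuki2012, status: disputed] -/
theorem ismPrintArch_eq_ismDH_of_not_isComplex {w : InfinitePlace F} (hw : ¬ w.IsComplex) :
    ismPrintArch logv (.inl w) = ismDH logv (.inl w) := by
  refine Set.Subset.antisymm ?_ (ismDH_subset_ismPrintArch logv (.inl w))
  intro g hg
  rcases hg with rfl | rfl | rfl | rfl
  · exact Or.inl rfl
  · exact Or.inr rfl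
  · exact Or.inl (conjCarrier_eq_refl_of_not_isComplex hw)
  · refine Or.inr ?_
    show (conjCarrier w).trans (LinearEquiv.neg ℚ) = LinearEquiv.neg ℚ
    rw [conjCarrier_eq_refl_of_not_isComplex hw]
    rfl

variable (X : PilotData F)

/-- **The real signature with the PRINT-LITERAL (Ind2) at `∞`**: abc-iut-c312-1's `Real.logShells` with c312-5's
trivialised strip-automorphisms `stripAutDH` and the binder `ismPrintArch` (= `ismDH` at the primes, the Klein
four-group at `∞`). [claim: Mochizuki2012, status: disputed] -/
def logShellsPrintArch : LogShells (thetaIndex X) :=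
  logShells X logv stripAutDH (ismPrintArch logv) refl_mem_stripAutDH (refl_mem_ismPrintArch logv)

/-! ## 3. The enlargement is numerically idle: isometries, print's integral structure, w5-d163's presentation -/

/-- **Every element of the print-literal binder at `∞` is read in `ℂ` as a real-linear isometry** (`1`, `−1`,
`Complex.conjLIE`, `−conjLIE`). [claim: Mochizuki2012, status: disputed] -/
theorem isometric_ismPrintArch_inl (w : ArchFibre X) :
    ∀ g ∈ ismPrintArch logv w.1, ∃ σ : ℂ ≃ₗᵢ[ℝ] ℂ, ∀ a, archEmb X w (g a) = σ (archEmb X w a) := by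
  obtain ⟨x, hx⟩ := w
  rcases x with w' | v
  · intro g hg
    rcases hg with rfl | rfl | rfl | rfl
    · exact isometric_refl X ⟨.inl w', hx⟩
    · exact isometric_neg X ⟨.inl w', hx⟩
    · exact ⟨Complex.conjLIE, fun a => by
        rw [Complex.conjLIE_apply]
        exact extensionEmbedding_conjCarrier w' a⟩
    · exact ⟨Complex.conjLIE.trans (LinearIsometryEquiv.neg ℝ), fun a => by
        rw [LinearEquiv.trans_apply, LinearEquiv.neg_apply, map_neg, LinearIsometryEquiv.trans_apply,
          LinearIsometryEquiv.coe_neg, Complex.conjLIE_apply]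
        exact congrArg Neg.neg (extensionEmbedding_conjCarrier w' a)⟩
  · exact absurd hx (by simp [thetaIndex])

section Hermitian

variable [Fintype (ArchFibre X)]

/-- **At the print-literal signature, EVERY element of (Ind2) at `∞` fixes print's archimedean integral structure
`𝓘(^{S^±_{j+1}}𝒟⊢_∞)`** (this seat's `archPkHermitian`; the general lemma `preimage_archPkHermitian_of_mem_Ind2` of
`Thm311RealArchHermitianIndDH`) — NO hypothesis. [claim: Mochizuki2012, status: disputed] -/
theorem preimage_archPkHermitian_of_mem_Ind2_printArch (j : (thetaIndex X).Label)
    {φ : (logShellsPrintArch logv X).Packet j (infty X) ≃ₗ[ℚ] (logShellsPrintArch logv X).Packet j (infty X)}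
    (hφ : φ ∈ (logShellsPrintArch logv X).Ind2 j (infty X)) :
    φ ⁻¹' archPkHermitian X logv stripAutDH (ismPrintArch logv) refl_mem_stripAutDH (refl_mem_ismPrintArch logv) j =
      archPkHermitian X logv stripAutDH (ismPrintArch logv) refl_mem_stripAutDH (refl_mem_ismPrintArch logv) j :=
  preimage_archPkHermitian_of_mem_Ind2 X logv stripAutDH (ismPrintArch logv) refl_mem_stripAutDH
    (refl_mem_ismPrintArch logv) j (isometric_ismPrintArch_inl logv X) hφ

/-- The `∞`-component of every element of (Ind1) fixes print's archimedean integral structure at the print-literal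
signature too (strip-automorphisms unchanged: `stripAutDH = {1}`). [claim: Mochizuki2012, status: disputed] -/
theorem preimage_archPkHermitian_of_mem_Ind1_printArch (j : (thetaIndex X).Label)
    {Φ : ∀ vQ : (thetaIndex X).VQ,
      (logShellsPrintArch logv X).Packet j vQ ≃ₗ[ℚ] (logShellsPrintArch logv X).Packet j vQ}
    (hΦ : Φ ∈ (logShellsPrintArch logv X).Ind1 j) :
    Φ (infty X) ⁻¹' archPkHermitian X logv stripAutDH (ismPrintArch logv) refl_mem_stripAutDH
        (refl_mem_ismPrintArch logv) j =
      archPkHermitian X logv stripAutDH (ismPrintArch logv) refl_mem_stripAutDH (refl_mem_ismPrintArch logv) j :=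
  preimage_archPkHermitian_of_mem_Ind1 X logv stripAutDH (ismPrintArch logv) refl_mem_stripAutDH
    (refl_mem_ismPrintArch logv) j (isometric_stripAutDH_inl X) hΦ

end Hermitian

/-- **abc-iut-w5-d163's archimedean presentation EXISTS VERBATIM over the print-literal signature** (under
[IUTchI] Def. 3.1 (a) "`√−1 ∈ F`", as for `archPresentationDH`): `φ_v = extensionEmbedding`, shell = closed ball of
radius `π`, strip-automorphisms trivial, and the four order-≤2 automorphisms `1, −1, conj, −conj` acting by the
isometries `1, −1, conjLIE, −conjLIE` of `ℂ`. Hence w5-d163's entire archimedean container (`toLocalPieces`: `M_I`,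
admissibility, the normalised packet log-volume, (Ind1)/(Ind2)-invariance) is available over it with the same values.
[claim: Mochizuki2012, status: disputed] -/
def archPresentationPrintArch (hc : ∀ w : InfinitePlace F, w.IsComplex) :
    Cor312Vol.ArchPresentation (logShellsPrintArch logv X) (.inl ()) where
  φ := archφ X logv hc
  shell_eq := (archPresentationDH X logv hc).shell_eq
  strip_isometry := (archPresentationDH X logv hc).strip_isometry
  ism_isometry := by
    rintro ⟨x1, h⟩ g hg
    rcases x1 with w | v
    · have key : ∀ a, archφ X logv hc ⟨.inl w, h⟩ a = archEmb X ⟨.inl w, h⟩ a := fun a =>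
        archφ_apply X logv hc w h a
      obtain ⟨σ, hσ⟩ := isometric_ismPrintArch_inl logv X ⟨.inl w, h⟩ g hg
      exact ⟨σ, fun a => ((key (g a)).trans (hσ a)).trans (congrArg σ (key a).symm)⟩
    · exact absurd h (by simp [thetaIndex, Place.under])

/-- The local pieces over the print-literal signature have the SAME summands, admissibility and log-measure as
w5-d163's over `logShellsDH` (all three are read off `Φ₀` alone). [folklore] -/
theorem toLocalPieces_printArch_X_eq (hc : ∀ w : InfinitePlace F, w.IsComplex) (j : (thetaIndex X).Label) (u : Unit) :
    (archPresentationPrintArch logv X hc).toLocalPieces.X j u = (archPresentationDH X logv hc).toLocalPieces.X j u :=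
  rfl

/-- Same admissibility predicate at `∞`. [folklore] -/
theorem toLocalPieces_printArch_adm_eq (hc : ∀ w : InfinitePlace F, w.IsComplex) (j : (thetaIndex X).Label)
    (u : Unit) :
    (archPresentationPrintArch logv X hc).toLocalPieces.adm j u = (archPresentationDH X logv hc).toLocalPieces.adm j u :=
  rfl

/-- Same log-measure at `∞`. [folklore] -/
theorem toLocalPieces_printArch_logμ_eq (hc : ∀ w : InfinitePlace F, w.IsComplex) (j : (thetaIndex X).Label)
    (u : Unit) :
    (archPresentationPrintArch logv X hc).toLocalPieces.logμ j u =
      (archPresentationDH X logv hc).toLocalPieces.logμ j u :=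
  rfl

/-- Same weight (`1`) at `∞`. [folklore] -/
theorem toLocalPieces_printArch_w_eq (hc : ∀ w : InfinitePlace F, w.IsComplex) (j : (thetaIndex X).Label)
    (u : Unit) :
    (archPresentationPrintArch logv X hc).toLocalPieces.w j u = (archPresentationDH X logv hc).toLocalPieces.w j u :=
  rfl

/-- **`GeneratorsPreserve` at `∞` for the print-literal signature** (w5-d163's generic
`ArchPresentation.generatorsPreserve_toLocalPieces`): capsule permutations, strip-automorphisms and ALL FOUR
archimedean order-≤2 automorphisms preserve admissibility and the log-measure. [claim: Mochizuki2012, status: disputed] -/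
theorem generatorsPreservePrintArch (hc : ∀ w : InfinitePlace F, w.IsComplex) :
    (archPresentationPrintArch logv X hc).toLocalPieces.GeneratorsPreserve :=
  (archPresentationPrintArch logv X hc).generatorsPreserve_toLocalPieces

end Summit.ABC.IUTFork.Thm311.Real

end
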